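import Mathlib
import Summits.Ventures.HodgeRepro.Tier3ContinuationFactorisation

/-!
# Tier3ContinuationValue — the factor at `s₀` IS the value of the continued matrix-coefficient zeta integral
(T3.5 for T3.1; PERIOD-ADDENDUM-9 §A9.3 step 4, the clause «writing `S(v₁, v₂) :=` the value at `s₀` of the
continued matrix-coefficient zeta integral of `τ`»)

Tier3ContinuationFactorisation proves that the factorised doubling pairing
`Z s (v₁, e₁) (v₂, e₂) = S s v₁ v₂ * B e₁ e₂` (`Re s > a`) still factors at every `s₀` off the polar set `P`:
`∃ S₀, Z s₀ (v₁, e₁) (v₂, e₂) = S₀ v₁ v₂ * B e₁ e₂`.  There `S₀` is produced by a quotient and nothing is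
assumed about the continuation of `S` itself.  Step 4 of §A9.3 says more — «both sides are meromorphic in
`s`» — and then DEFINES `S(v₁, v₂)` as the value at `s₀` of the continued matrix-coefficient zeta integral.
This file is that clause: when `s ↦ S s v₁ v₂` is also analytic off `P` (the hypothesis `hS`), the factor at
`s₀` is `S s₀` itself (`eq_mul_of_analytic`); the factor at `s₀` is unique as soon as `B ≢ 0`
(`factor_unique`), so the existential `S₀` of Tier3ContinuationFactorisation is `S s₀` (`factor_eq_of_analytic`);
the orthonormal form of (★) holds with `S s₀` in place of `S₀` (`forall_ite_of_orthonormal_of_analytic`), and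
`S s₀ v w ≠ 0` makes every copy's self-pairing non-zero (`apply_self_ne_zero_of_ne_zero`) — «all NON-ZERO as
soon as one is (`S ≠ 0`)».  Found by the gen-12 non-author twin-fidelity read of the gen-11 modules
(T3-P1-NOTE-g12-TWINS §3, nuance N5).
What stays on the page: the meromorphy of the matrix-coefficient zeta integral (its Euler-product evaluation,
Harris Thm 5.15, PRINTED; the hypothesis `hS`) and everything Tier3ContinuationFactorisation already leaves there.
No definition, no notation; imports Mathlib and Tier3ContinuationFactorisation.
Nothing here asserts anything about the original programme; HC_CM is NOT proved by anyone in this repository.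
-/

namespace HodgeRepro.T3P1.ContinuationValue

open HodgeRepro.T3P1.ContinuationFactorisation

variable {τ M : Type*}

/-- **The factor at `s₀` is the continued `S` (§A9.3 step 4).** If `Z s x y` and `S s v₁ v₂` are analytic in
`s` off a countable closed `P` and `Z s (v₁, e₁) (v₂, e₂) = S s v₁ v₂ * B e₁ e₂` for `Re s > a` (off `P`), then
the same identity holds at every `s₀ ∉ P`. -/
theorem eq_mul_of_analytic {P : Set ℂ} (hPc : P.Countable) (hPcl : IsClosed P)
    (Z : ℂ → τ × M → τ × M → ℂ) (S : ℂ → τ → τ → ℂ) (B : M → M → ℂ)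
    (hZ : ∀ x y, AnalyticOnNhd ℂ (fun s => Z s x y) Pᶜ)
    (hS : ∀ v₁ v₂, AnalyticOnNhd ℂ (fun s => S s v₁ v₂) Pᶜ) {a : ℝ}
    (hfac : ∀ s : ℂ, a < s.re → s ∉ P →
      ∀ v₁ v₂ e₁ e₂, Z s (v₁, e₁) (v₂, e₂) = S s v₁ v₂ * B e₁ e₂)
    {s₀ : ℂ} (hs₀ : s₀ ∉ P) (v₁ v₂ : τ) (e₁ e₂ : M) :
    Z s₀ (v₁, e₁) (v₂, e₂) = S s₀ v₁ v₂ * B e₁ e₂ :=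
  eq_of_eqOn_halfplane hPc hPcl (hZ _ _) ((hS v₁ v₂).mul analyticOnNhd_const) (a := a)
    (fun s hs hsP => hfac s hs hsP v₁ v₂ e₁ e₂) hs₀

/-- **The factor is unique when `B ≢ 0`.** Two factorisations `Z (v₁, e₁) (v₂, e₂) = S₀ v₁ v₂ * B e₁ e₂`
and `= S₀' v₁ v₂ * B e₁ e₂` of the same pairing have `S₀ = S₀'` as soon as some `B e e' ≠ 0`. -/
theorem factor_unique (Z : τ × M → τ × M → ℂ) (B : M → M → ℂ) {S₀ S₀' : τ → τ → ℂ}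
    (h : ∀ v₁ v₂ e₁ e₂, Z (v₁, e₁) (v₂, e₂) = S₀ v₁ v₂ * B e₁ e₂)
    (h' : ∀ v₁ v₂ e₁ e₂, Z (v₁, e₁) (v₂, e₂) = S₀' v₁ v₂ * B e₁ e₂)
    (hB : ∃ e e', B e e' ≠ 0) : S₀ = S₀' := by
  obtain ⟨e, e', hee'⟩ := hB
  funext v₁ v₂
  exact mul_right_cancel₀ hee' ((h v₁ v₂ e e').symm.trans (h' v₁ v₂ e e'))

/-- The existential factor `S₀` of Tier3ContinuationFactorisation's `exists_factorisation_of_eqOn_halfplane`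
is the continued `S` at `s₀`, when `S` is analytic off `P` and `B ≢ 0`. -/
theorem factor_eq_of_analytic {P : Set ℂ} (hPc : P.Countable) (hPcl : IsClosed P)
    (Z : ℂ → τ × M → τ × M → ℂ) (S : ℂ → τ → τ → ℂ) (B : M → M → ℂ)
    (hZ : ∀ x y, AnalyticOnNhd ℂ (fun s => Z s x y) Pᶜ)
    (hS : ∀ v₁ v₂, AnalyticOnNhd ℂ (fun s => S s v₁ v₂) Pᶜ) {a : ℝ}
    (hfac : ∀ s : ℂ, a < s.re → s ∉ P →
      ∀ v₁ v₂ e₁ e₂, Z s (v₁, e₁) (v₂, e₂) = S s v₁ v₂ * B e₁ e₂)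
    {s₀ : ℂ} (hs₀ : s₀ ∉ P) (hB : ∃ e e', B e e' ≠ 0) {S₀ : τ → τ → ℂ}
    (hS₀ : ∀ v₁ v₂ e₁ e₂, Z s₀ (v₁, e₁) (v₂, e₂) = S₀ v₁ v₂ * B e₁ e₂) : S₀ = S s₀ :=
  factor_unique (Z s₀) B hS₀
    (fun v₁ v₂ e₁ e₂ => eq_mul_of_analytic hPc hPcl Z S B hZ hS hfac hs₀ v₁ v₂ e₁ e₂) hB

/-- **(★) in orthonormal form with the continued `S` itself.** For an orthonormal family `e i` of the
multiplicity space, `Z s₀ (v, e i) (w, e j) = if i = j then S s₀ v w else 0`. -/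
theorem forall_ite_of_orthonormal_of_analytic {P : Set ℂ} (hPc : P.Countable) (hPcl : IsClosed P)
    (Z : ℂ → τ × M → τ × M → ℂ) (S : ℂ → τ → τ → ℂ) (B : M → M → ℂ)
    (hZ : ∀ x y, AnalyticOnNhd ℂ (fun s => Z s x y) Pᶜ)
    (hS : ∀ v₁ v₂, AnalyticOnNhd ℂ (fun s => S s v₁ v₂) Pᶜ) {a : ℝ}
    (hfac : ∀ s : ℂ, a < s.re → s ∉ P →
      ∀ v₁ v₂ e₁ e₂, Z s (v₁, e₁) (v₂, e₂) = S s v₁ v₂ * B e₁ e₂)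
    {s₀ : ℂ} (hs₀ : s₀ ∉ P) {ι : Type*} [DecidableEq ι] (e : ι → M)
    (he : ∀ i j, B (e i) (e j) = if i = j then 1 else 0) (i j : ι) (v w : τ) :
    Z s₀ (v, e i) (w, e j) = if i = j then S s₀ v w else 0 := by
  rw [eq_mul_of_analytic hPc hPcl Z S B hZ hS hfac hs₀, he]
  split_ifs <;> simp

/-- «All non-zero as soon as one is»: if `S s₀ v w ≠ 0`, every copy `e i` of an orthonormal family has
`Z s₀ (v, e i) (w, e i) ≠ 0`. -/
theorem apply_self_ne_zero_of_ne_zero {P : Set ℂ} (hPc : P.Countable) (hPcl : IsClosed P)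
    (Z : ℂ → τ × M → τ × M → ℂ) (S : ℂ → τ → τ → ℂ) (B : M → M → ℂ)
    (hZ : ∀ x y, AnalyticOnNhd ℂ (fun s => Z s x y) Pᶜ)
    (hS : ∀ v₁ v₂, AnalyticOnNhd ℂ (fun s => S s v₁ v₂) Pᶜ) {a : ℝ}
    (hfac : ∀ s : ℂ, a < s.re → s ∉ P →
      ∀ v₁ v₂ e₁ e₂, Z s (v₁, e₁) (v₂, e₂) = S s v₁ v₂ * B e₁ e₂)
    {s₀ : ℂ} (hs₀ : s₀ ∉ P) {ι : Type*} [DecidableEq ι] (e : ι → M)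
    (he : ∀ i j, B (e i) (e j) = if i = j then 1 else 0) {v w : τ} (hvw : S s₀ v w ≠ 0) (i : ι) :
    Z s₀ (v, e i) (w, e i) ≠ 0 := by
  rw [forall_ite_of_orthonormal_of_analytic hPc hPcl Z S B hZ hS hfac hs₀ e he]
  simpa using hvw

end HodgeRepro.T3P1.ContinuationValue
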